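import Literature.NumberTheory.ComplexMultiplication.EllipticUnits.ImaginaryQuadraticMainConjectureLocalInputs
import Literature.NumberTheory.EllipticCurves.GreenbergSelmer
import HarnessLib

/-!
# (α3) KERNEL DESCENT — ROW 1, the LOCAL CLAUSES of `hplaces`: decompositions of a pin at a place, the local layer groups
# `Λ_n^{(w)} = φ_w⁻¹(V̄_n)`, and the two local laws (conjugation / kill) with the uniform exponent `e = 3`

Cell `bsd-print-cf2`, width seat `bsd-line-cf2c-w8` g10 (prover-bsd-line-cf2c-w8-g10-0), lane (α3) ROW 1 of the planner brief for the
DECIDING research child `PrintCf2RubinValueTwo.MainConjClauseAtSplitTwoQuadDA` (stmt-BirchSwinnertonDyer-24721, class door 23300, LEAD's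
`m_line_pin_class` stub `stub_classGroupHalf`); `--supports` it `--as helper`, Theses-free. Part 1 of 2 (part 2:
`…JLKDescentRowOneOfClass`, the assembly on the DA7 class frame). THEOREMS ONLY (no definition, no named fact, no instance, no `sorry`).

WHAT. cf2c-w8 g9's `JLKDescent.classGroupRow_hfcoker` (`…JLKDescentRowOneCokernel`) displays per-place local annihilation data `hplaces` on
the local groups `H²(Λ_n^{(w)}, res_{φ_w}(μ_{p^k} ⊗ θ′)^{N_S})`: at each `w ∈ supp(p𝔣)` EITHER a kill `p^e·c = 0`, OR, for both pins `ηᵢ`, a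
DECOMPOSITION `ηᵢ = res_w(δᵢ)·hᵢ` (`hᵢ ∈ Gal(K̄/K̃_∞)`) with a conjugation law `p^e·(δᵢ·c − uᵢ·c) = 0`. This file supplies the generic pieces:

* §1 `exists_mem_apply_eq_of_isClosed` — **a closed subgroup of `Γ_K` containing a topological generator of `κ : Γ_K ↠ ℤ_p` maps ONTO `ℤ_p`**
  (compact image containing the dense `ℤ`); `exists_inv_eq_absGaloisRestrict_mul` — **the decomposition `g⁻¹ = res_w(δ)·h`, `κ h = κ′ h = 1`**,
  as soon as `D_w` contains a generator of `κ` killed by `κ′` and meets the fibre `κ′ = κ′(g)`.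
* §2 the local layer groups `Λ_n^{(w)} = ((V_n).map π).comap φ_w`: normal, open, abelian quotient, contain `res_w⁻¹ Gal(K̄/K̃_∞)`; the local `H²`
  are `p^k`-torsion; and (for `p = 2`, `θ′` with values `±1`, `N_S ≤ ker(μ_{2^k} ⊗ θ′)`) the two LOCAL LAWS with `e = 3` uniformly in `k`:
  `pow_three_smul_conjMap_sub_zsmul_eq_zero` (`2³·(δ·c − u·c) = 0` for EVERY `δ`, `u = θ′(res_w δ)`; from cf2c-w8 g9's
  `two_smul_conjMap_sub_zsmul_eq_zero` for `k ≥ 2` — the `2^k`-torsion turns `(θ′ mod 2^k).val` into `u ∈ ℤ` — and from torsion for `k ≤ 1`)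
  and `pow_three_smul_eq_zero_of_apply_eq_neg_one` (`2³·c = 0` when `Λ ∋ g₀` with `θ′(res_w g₀) = −1`; g9's `four_smul_eq_zero_of_apply_eq_neg_one`).
* §3 the two CLAUSES of `hplaces` at a place `w` in their displayed shape: `conjClause_of_decomp`, `killClause_of_mem_pairKer`.

HONEST FRAMING: bookkeeping over the Literature sockets (the local class field theory input (LI) is g9's PROVED `LocalTwoMuConjTrivial`); no summit
statement is proved by this seat; BSD is not proved by any of this. presearch: JLK 2011 §5.4 Lemma 5.8 (proof), Serre CG I §2, Washington §13.1 —
folklore over the tree's sockets (memo `Cruxes/MainConjClauseAtSplitTwoQuadDA/ROW1-COKERNEL-LOCAL-INPUT-cf2c-w8g9.md` §2c (i)–(v)); no new fact.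
beyond-print theorem: no.

References: J. Johnson-Leung, G. Kings, J. reine angew. Math. 653 (2011) §4.1, §5.4 Lemma 5.8 [JohnsonLeungKings2011]; J.-P. Serre, *Galois
Cohomology* (1997) I §2.2, §2.4 Prop. 9 [SerreGaloisCohomology1997]; J.-P. Serre, *Local Fields* (1979) VII §5 Prop. 3 [SerreLocalFields1979];
J. S. Milne, *Arithmetic Duality Theorems* (2006) I §4 (p. 56) [MilneADT2006]; J. Neukirch (1999) II §9 (9.6) [NeukirchANT1999];
L. Washington (1997) §13.1, Prop. 13.2 [Washington1997].
-/

noncomputable section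

set_option linter.dupNamespace false -- D-0017: single-problem summit, `…BirchSwinnertonDyer.BirchSwinnertonDyer…` repeats a namespace by design
set_option autoImplicit false

open scoped NumberField
open CategoryTheory Function Field IsDedekindDomain NumberField
open Literature.NumberTheory.GaloisRepresentations
open Literature.NumberTheory.GaloisRepresentations.DiscreteGaloisModule
open Literature.NumberTheory.EllipticCurves
open Literature.NumberTheory.EllipticCurves.GreenbergSelmer (inertia decomp mem_decomp_iff inertia_le_decomp)
open Literature.NumberTheory.GaloisCohomology.ShaLayer (locHom)
open Literature.NumberTheory.ComplexMultiplication.EllipticUnits.JohnsonLeungKings2011 (pairLayerSubgroup muTwist charModPow charModPow_apply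
  isOpen_pairLayerSubgroup pairKer_le_pairLayerSubgroup)
open Literature.NumberTheory.ComplexMultiplication.EllipticUnits.JohnsonLeungKings2011.ClassGroupRow

namespace Summit.BirchSwinnertonDyer.BirchSwinnertonDyer.Theorems.PrintCf2.JLKDescent

/-! ## §1. Decompositions at a place: a closed subgroup containing a topological generator maps onto `ℤ_p` -/

section Decomp

variable {K : Type} [Field K] [NumberField K] {p : ℕ} [Fact p.Prime]

/-- **A closed subgroup `C ≤ Γ_K` containing a topological generator `γ` of `κ` maps ONTO `ℤ_p` under `κ`**: `κ(C)` is compact, hence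
closed, and contains `κ(γ^ℤ) = ℤ`, which is dense in `ℤ_p`. [cite: Washington1997, §13.1] -/
theorem exists_mem_apply_eq_of_isClosed (κ : ZpExtension K p) {C : Subgroup (absoluteGaloisGroup K)}
    (hC : IsClosed (C : Set (absoluteGaloisGroup K))) {γ : absoluteGaloisGroup K} (hγC : γ ∈ C) (hγ : κ.IsTopGenerator γ)
    (x : Multiplicative ℤ_[p]) : ∃ σ ∈ C, κ σ = x := by
  have hcomp : IsCompact ((fun σ : absoluteGaloisGroup K => κ σ) '' (C : Set (absoluteGaloisGroup K))) :=
    hC.isCompact.image κ.toContinuousMonoidHom.continuous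
  have hclosed : IsClosed (Multiplicative.ofAdd ⁻¹' ((fun σ : absoluteGaloisGroup K => κ σ) '' (C : Set (absoluteGaloisGroup K)))) :=
    hcomp.isClosed.preimage continuous_ofAdd
  have hsub : Set.range (Int.cast : ℤ → ℤ_[p]) ⊆
      Multiplicative.ofAdd ⁻¹' ((fun σ : absoluteGaloisGroup K => κ σ) '' (C : Set (absoluteGaloisGroup K))) := by
    rintro _ ⟨n, rfl⟩
    refine ⟨γ ^ n, C.zpow_mem hγC n, ?_⟩
    change κ (γ ^ n) = Multiplicative.ofAdd (n : ℤ_[p])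
    rw [map_zpow, hγ, ← ofAdd_zsmul, zsmul_eq_mul, mul_one]
  have hall : (Set.univ : Set ℤ_[p]) ⊆
      Multiplicative.ofAdd ⁻¹' ((fun σ : absoluteGaloisGroup K => κ σ) '' (C : Set (absoluteGaloisGroup K))) := by
    rw [← (PadicInt.denseRange_intCast (p := p)).closure_eq]
    exact closure_minimal hsub hclosed
  obtain ⟨σ, hσC, hσ⟩ := hall (Set.mem_univ x.toAdd)
  exact ⟨σ, hσC, by rwa [ofAdd_toAdd] at hσ⟩

/-- `D_w` is closed (the continuous image of the compact `Γ_{K_w}`). [cite: NeukirchANT1999, Ch. II §9 (9.6)] -/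
theorem isClosed_decomp (w : HeightOneSpectrum (𝓞 K)) : IsClosed ((decomp (K := K) w : Subgroup (absoluteGaloisGroup K)) : Set (absoluteGaloisGroup K)) := by
  haveI := absoluteGaloisGroup_compactSpace (w.adicCompletion K)
  change IsClosed (Set.range fun σ : absoluteGaloisGroup (w.adicCompletion K) => absGaloisRestrict K (w.adicCompletion K) σ)
  exact (isCompact_range (absGaloisRestrict K (w.adicCompletion K)).continuous).isClosed

/-- **DECOMPOSITION OF A PIN AT A PLACE.** `κ, κ′ : Γ_K → ℤ_p`, `w` a finite place, `γ ∈ D_w` a topological generator of `κ` killed by `κ′`;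
if `κ′(g)` is a value of `κ′` on `D_w` (`κ′ τ = κ′ g`, `τ ∈ D_w`), then `g⁻¹ = res_w(δ) · h` with `κ h = κ′ h = 1` (`h ∈ Gal(K̄/K̃_∞)`): correct `τ` by
an element of the closed subgroup `D_w ∩ ker κ′ ∋ γ`, on which `κ` is onto (`exists_mem_apply_eq_of_isClosed`). [cite: Washington1997, §13.1] [cite: NeukirchANT1999, Ch. II §9 (9.6)] -/
theorem exists_inv_eq_absGaloisRestrict_mul (κ κ' : ZpExtension K p) (w : HeightOneSpectrum (𝓞 K)) {γ : absoluteGaloisGroup K}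
    (hγw : γ ∈ decomp w) (hγ : κ.IsTopGenerator γ) (hγ' : κ' γ = 1) {g τ : absoluteGaloisGroup K} (hτ : τ ∈ decomp w)
    (hτg : κ' τ = κ' g) :
    ∃ (δ : absoluteGaloisGroup (w.adicCompletion K)) (h : absoluteGaloisGroup K),
      κ h = 1 ∧ κ' h = 1 ∧ g⁻¹ = absGaloisRestrict K (w.adicCompletion K) δ * h := by
  have hC : IsClosed (((decomp w ⊓ κ'.kerSubgroup : Subgroup (absoluteGaloisGroup K))) : Set (absoluteGaloisGroup K)) := by
    rw [Subgroup.coe_inf]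
    exact (isClosed_decomp w).inter κ'.isClosed_kerSubgroup
  obtain ⟨σ, hσ, hκσ⟩ := exists_mem_apply_eq_of_isClosed κ hC (Subgroup.mem_inf.mpr ⟨hγw, ZpExtension.mem_kerSubgroup.mpr hγ'⟩) hγ
    ((κ τ)⁻¹ * κ g)
  obtain ⟨hσw, hσ'⟩ := Subgroup.mem_inf.mp hσ
  obtain ⟨δ, hδ⟩ := (mem_decomp_iff w _).mp (inv_mem (mul_mem hτ hσw))
  refine ⟨δ, τ * σ * g⁻¹, ?_, ?_, ?_⟩
  · rw [map_mul, map_mul, map_inv, hκσ, mul_inv_cancel_left, mul_inv_cancel]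
  · rw [map_mul, map_mul, map_inv, ZpExtension.mem_kerSubgroup.mp hσ', mul_one, hτg, mul_inv_cancel]
  · rw [hδ, inv_mul_cancel_left]

end Decomp

/-! ## §2. The local layer groups `Λ_n^{(w)} = φ_w⁻¹(V̄_n)`: normal, open, abelian quotient; the two local laws with `e = 3` -/

section LocalLayer

variable {K : Type} [Field K] [NumberField K] {p : ℕ} [Fact p.Prime] (κ₁ κ₂ : ZpExtension K p)
  (S : Set (HeightOneSpectrum (𝓞 K))) (w : HeightOneSpectrum (𝓞 K)) (n : ℕ)

omit [NumberField K] in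
/-- Commutators lie in `V_n = Gal(K̄/K̃_n)` (`Γ_K/V_n ↪ (ℤ_p/pⁿ)²` is abelian). [cite: JohnsonLeungKings2011, §4.1 (arXiv p0012:L7–14)] -/
theorem commutator_mem_pairLayerSubgroup (x y : absoluteGaloisGroup K) : x * y * x⁻¹ * y⁻¹ ∈ pairLayerSubgroup κ₁ κ₂ n := by
  have h : ∀ κ : ZpExtension K p, x * y * x⁻¹ * y⁻¹ ∈ κ.layerSubgroup n := fun κ => by
    have h1 : κ (x * y * x⁻¹ * y⁻¹) = 1 := by
      rw [map_mul, map_mul, map_mul, map_inv, map_inv, mul_comm (κ x) (κ y), mul_inv_cancel_right, mul_inv_cancel]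
    rw [ZpExtension.mem_layerSubgroup, h1, toAdd_one]
    exact dvd_zero _
  exact Subgroup.mem_inf.mpr ⟨h κ₁, h κ₂⟩

/-- `Λ_n^{(w)} = φ_w⁻¹(V̄_n) ⊴ Γ_{K_w}` is normal. [cite: MilneADT2006, I §4 (p. 56)] -/
theorem normal_comap_locHom_map_pairLayerSubgroup :
    (((pairLayerSubgroup κ₁ κ₂ n).map (toUnramifiedQuot K S)).comap
      (locHom (S := S) w : absoluteGaloisGroup (w.adicCompletion K) →* GaloisGroupUnramifiedOutside K S)).Normal := by
  haveI : ((pairLayerSubgroup κ₁ κ₂ n).map (toUnramifiedQuot K S)).Normal :=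
    Subgroup.Normal.map inferInstance _ (toUnramifiedQuot_surjective K S)
  infer_instance

/-- `Λ_n^{(w)}` is open. [cite: MilneADT2006, I §4 (p. 56)] -/
theorem isOpen_comap_locHom_map_pairLayerSubgroup :
    IsOpen ((((pairLayerSubgroup κ₁ κ₂ n).map (toUnramifiedQuot K S)).comap
      (locHom (S := S) w : absoluteGaloisGroup (w.adicCompletion K) →* GaloisGroupUnramifiedOutside K S) :
        Subgroup (absoluteGaloisGroup (w.adicCompletion K))) : Set (absoluteGaloisGroup (w.adicCompletion K))) :=
  (Literature.NumberTheory.GaloisCohomology.ShaLayer.isOpen_map_toUnramifiedQuot S _ (isOpen_pairLayerSubgroup κ₁ κ₂ n)).preimage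
    (locHom (S := S) w).continuous_toFun

/-- `Γ_{K_w}/Λ_n^{(w)}` is abelian (it embeds in `Γ_K/V_n`). [cite: MilneADT2006, I §4 (p. 56)] -/
theorem commutator_mem_comap_locHom_map_pairLayerSubgroup (x y : absoluteGaloisGroup (w.adicCompletion K)) :
    x * y * x⁻¹ * y⁻¹ ∈ ((pairLayerSubgroup κ₁ κ₂ n).map (toUnramifiedQuot K S)).comap
      (locHom (S := S) w : absoluteGaloisGroup (w.adicCompletion K) →* GaloisGroupUnramifiedOutside K S) := by
  refine Subgroup.mem_comap.mpr ?_
  have h := commutator_mem_pairLayerSubgroup κ₁ κ₂ n (absGaloisRestrict K (w.adicCompletion K) x)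
    (absGaloisRestrict K (w.adicCompletion K) y)
  rw [← map_inv, ← map_inv, ← map_mul, ← map_mul, ← map_mul] at h
  change toUnramifiedQuot K S (absGaloisRestrict K (w.adicCompletion K) (x * y * x⁻¹ * y⁻¹)) ∈ _
  exact Subgroup.mem_map_of_mem (toUnramifiedQuot K S) h

/-- An element of `Γ_{K_w}` whose image in `Γ_K` lies in `Gal(K̄/K̃_∞)` lies in every `Λ_n^{(w)}`. [cite: MilneADT2006, I §4 (p. 56)] -/
theorem mem_comap_locHom_map_pairLayerSubgroup_of_mem_pairKer {g : absoluteGaloisGroup (w.adicCompletion K)}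
    (hg : absGaloisRestrict K (w.adicCompletion K) g ∈ ZpExtension.pairKer κ₁ κ₂) :
    g ∈ ((pairLayerSubgroup κ₁ κ₂ n).map (toUnramifiedQuot K S)).comap
      (locHom (S := S) w : absoluteGaloisGroup (w.adicCompletion K) →* GaloisGroupUnramifiedOutside K S) :=
  Subgroup.mem_comap.mpr (Subgroup.mem_map_of_mem (toUnramifiedQuot K S) (pairKer_le_pairLayerSubgroup κ₁ κ₂ n hg))

/-- The local groups `H²(Λ, res_{φ_w}(μ_{p^k} ⊗ θ′)^{N_S})` are `p^k`-torsion. [cite: SerreGaloisCohomology1997, I §2.2] -/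
theorem pow_smul_continuousCohomology_two_eq_zero (θ' : absoluteGaloisGroup K →ₜ* ℤ_[p]ˣ) (k : ℕ)
    (Λ : Subgroup (absoluteGaloisGroup (w.adicCompletion K))) (hΛo : IsOpen (Λ : Set (absoluteGaloisGroup (w.adicCompletion K))))
    (c : continuousCohomology 2 (subgroupRep (TopRep.res (locHom (S := S) w : absoluteGaloisGroup (w.adicCompletion K) →*
      GaloisGroupUnramifiedOutside K S) ((muTwist p θ' k).quotientInvariants (ramificationSubgroup K S)).toTopRep) Λ)) :
    p ^ k • c = 0 := by
  haveI := absoluteGaloisGroup_compactSpace (w.adicCompletion K)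
  haveI hΛc : IsClosed (Λ : Set (absoluteGaloisGroup (w.adicCompletion K))) := Subgroup.isClosed_of_isOpen _ hΛo
  haveI : CompactSpace Λ := compactSpace_of_isClosed_subgroup (S := Λ)
  exact nsmul_two_eq_zero_of_forall _ (p ^ k) (fun x => Subtype.ext (muVal_injective K (p ^ k) (by
    rw [show ((((p ^ k) • x : ↥((muTwist p θ' k).invariantsOf (ramificationSubgroup K S))) : MuCarrier K (p ^ k))) =
        (p ^ k) • (x : MuCarrier K (p ^ k)) from rfl, muVal_nsmul, muVal_pow_eq_one]
    rfl))) c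

end LocalLayer

section LocalLaws

variable {K : Type} [Field K] [NumberField K] (θ' : absoluteGaloisGroup K →ₜ* ℤ_[2]ˣ)
  (S : Set (HeightOneSpectrum (𝓞 K))) (w : HeightOneSpectrum (𝓞 K))
  (hμ : ∀ k : ℕ, ramificationSubgroup K S ≤ ContinuousRep.ker (muTwist 2 θ' k))
  (hθ2 : ∀ s : absoluteGaloisGroup K, θ' s = 1 ∨ θ' s = -1)
  (Λ : Subgroup (absoluteGaloisGroup (w.adicCompletion K))) [Λ.Normal]
  (hΛo : IsOpen (Λ : Set (absoluteGaloisGroup (w.adicCompletion K))))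
  (habΛ : ∀ x y : absoluteGaloisGroup (w.adicCompletion K), x * y * x⁻¹ * y⁻¹ ∈ Λ)

omit [NumberField K] in
/-- `(θ′(g) mod 2^k).val • w = −w` on a `2^k`-torsion element when `θ′(g) = −1`. [folklore] -/
theorem val_charModPow_zsmul_eq_neg_of_apply_eq_neg_one {M : Type*} [AddCommGroup M] (k : ℕ) (g : absoluteGaloisGroup K)
    (hθg : θ' g = -1) (x : M) (hx : (2 ^ k) • x = 0) :
    ((charModPow 2 θ' k g).val : ℤ) • x = (-1 : ℤ) • x := by
  have hc : charModPow 2 θ' k g = -1 := by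
    rw [charModPow_apply, hθg, Units.val_neg, Units.val_one, map_neg, map_one]
  have hcast : (((charModPow 2 θ' k g).val : ℤ) : ZMod (2 ^ k)) = ((-1 : ℤ) : ZMod (2 ^ k)) := by
    rw [Int.cast_natCast, ZMod.natCast_zmod_val, hc, Int.cast_neg, Int.cast_one]
  obtain ⟨m, hm⟩ := (ZMod.intCast_eq_intCast_iff_dvd_sub _ _ (2 ^ k)).mp hcast
  have e : (-1 : ℤ) = ((charModPow 2 θ' k g).val : ℤ) + m * (2 ^ k : ℕ) := by rw [mul_comm, ← hm]; ring
  rw [e, add_zsmul, mul_zsmul, natCast_zsmul x (2 ^ k), hx, zsmul_zero, add_zero]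

omit [NumberField K] in
/-- `(θ′(g) mod 2^k).val • w = w` when `θ′(g) = 1` and `k ≥ 1`. [folklore] -/
theorem val_charModPow_zsmul_eq_of_apply_eq_one {M : Type*} [AddCommGroup M] {k : ℕ} (hk : 1 ≤ k) (g : absoluteGaloisGroup K)
    (hθg : θ' g = 1) (x : M) :
    ((charModPow 2 θ' k g).val : ℤ) • x = (1 : ℤ) • x := by
  have h1 : 1 < 2 ^ k := Nat.one_lt_two_pow (by omega)
  rw [charModPow_apply, hθg, Units.val_one, map_one, ZMod.val_one_eq_one_mod, Nat.mod_eq_of_lt h1, Nat.cast_one]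

include hμ hθ2 hΛo habΛ in
/-- **THE CONJUGATION LAW with the uniform exponent `e = 3`** (the (LI-conj) clause of `classGroupRow_hfcoker`'s `hplaces`): on
`H²(Λ, res_{φ_w}(μ_{2^k} ⊗ θ′)^{N_S})`, `Λ ⊴ Γ_{K_w}` open with abelian quotient, `θ′` with values `±1`, `N_S ≤ ker(μ_{2^k} ⊗ θ′)`:
`2³ · (δ·c − u·c) = 0` for EVERY `δ ∈ Γ_{K_w}` and `u = θ′(res_w δ) ∈ {±1}` read in `ℤ` — for `k ≥ 2` from cf2c-w8 g9's
`two_smul_conjMap_sub_zsmul_eq_zero` (`2^k`-torsion turns `(θ′ mod 2^k).val` into `u`), for `k ≤ 1` from `2^k`-torsion.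
[cite: JohnsonLeungKings2011, §5.4 Lemma 5.8 (proof)] [cite: SerreGaloisCohomology1997, I §2.4 Prop. 9] -/
theorem pow_three_smul_conjMap_sub_zsmul_eq_zero (δ : absoluteGaloisGroup (w.adicCompletion K)) {u : ℤ}
    (hu : (θ' (absGaloisRestrict K (w.adicCompletion K) δ) = 1 ∧ u = 1) ∨ (θ' (absGaloisRestrict K (w.adicCompletion K) δ) = -1 ∧ u = -1))
    (k : ℕ) (c : continuousCohomology 2 (subgroupRep (TopRep.res (locHom (S := S) w : absoluteGaloisGroup (w.adicCompletion K) →*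
      GaloisGroupUnramifiedOutside K S) ((muTwist 2 θ' k).quotientInvariants (ramificationSubgroup K S)).toTopRep) Λ)) :
    2 ^ 3 • ((conjMap (TopRep.res (locHom (S := S) w : absoluteGaloisGroup (w.adicCompletion K) →*
        GaloisGroupUnramifiedOutside K S) ((muTwist 2 θ' k).quotientInvariants (ramificationSubgroup K S)).toTopRep) Λ δ 2).hom c -
      u • c) = 0 := by
  have htor := pow_smul_continuousCohomology_two_eq_zero S w θ' k Λ hΛo
  rcases Nat.lt_or_ge k 2 with hk | hk
  · -- `k ≤ 1`: everything is `2^k`-torsion with `2^k ∣ 2^3`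
    have hsplit : 2 ^ 3 = 2 ^ (3 - k) * 2 ^ k := by rw [← pow_add]; congr 1; omega
    have hzero : 2 ^ k • ((conjMap (TopRep.res (locHom (S := S) w : absoluteGaloisGroup (w.adicCompletion K) →*
        GaloisGroupUnramifiedOutside K S) ((muTwist 2 θ' k).quotientInvariants (ramificationSubgroup K S)).toTopRep) Λ δ 2).hom c -
      u • c) = 0 := by
      rw [nsmul_sub, ← map_nsmul, htor c, map_zero, smul_comm, htor c, zsmul_zero, sub_zero]
    rw [hsplit, mul_nsmul', hzero, smul_zero]
  · have h2 := two_smul_conjMap_sub_zsmul_eq_zero 2 θ' S k w Λ hk (hμ k) hΛo habΛ (fun s => hθ2 _) δ c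
    have hval : ((charModPow 2 θ' k (absGaloisRestrict K (w.adicCompletion K) δ)).val : ℤ) • c = u • c := by
      rcases hu with ⟨h1, rfl⟩ | ⟨h1, rfl⟩
      · exact val_charModPow_zsmul_eq_of_apply_eq_one θ' (by omega) _ h1 c
      · exact val_charModPow_zsmul_eq_neg_of_apply_eq_neg_one θ' k _ h1 c (htor c)
    rw [← hval, show (2 ^ 3 : ℕ) = 2 ^ 2 * 2 from rfl, mul_nsmul']
    change 2 ^ 2 • (2 • (conjMap (TopRep.res (locHom (S := S) w : absoluteGaloisGroup (w.adicCompletion K) →*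
        GaloisGroupUnramifiedOutside K S) ((muTwist 2 θ' k).quotientInvariants (ramificationSubgroup K S)).toTopRep) Λ δ 2 c -
      ((charModPow 2 θ' k (absGaloisRestrict K (w.adicCompletion K) δ)).val : ℤ) • c)) = 0
    rw [h2, smul_zero]

include hμ hθ2 hΛo habΛ in
/-- **THE KILL LAW with the uniform exponent `e = 3`** (the (LI-ram) clause of `hplaces`): if `Λ` contains `g₀` with `θ′(res_w g₀) = −1`
then `2³ · c = 0` on `H²(Λ, res_{φ_w}(μ_{2^k} ⊗ θ′)^{N_S})` — for `k ≥ 2` from cf2c-w8 g9's `four_smul_eq_zero_of_apply_eq_neg_one`, for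
`k ≤ 1` from `2^k`-torsion. [cite: JohnsonLeungKings2011, §5.4 Lemma 5.8 (proof)] [cite: SerreLocalFields1979, VII §5 Prop. 3] -/
theorem pow_three_smul_eq_zero_of_apply_eq_neg_one {g₀ : absoluteGaloisGroup (w.adicCompletion K)} (hg₀ : g₀ ∈ Λ)
    (hθg₀ : θ' (absGaloisRestrict K (w.adicCompletion K) g₀) = -1) (k : ℕ)
    (c : continuousCohomology 2 (subgroupRep (TopRep.res (locHom (S := S) w : absoluteGaloisGroup (w.adicCompletion K) →*
      GaloisGroupUnramifiedOutside K S) ((muTwist 2 θ' k).quotientInvariants (ramificationSubgroup K S)).toTopRep) Λ)) :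
    2 ^ 3 • c = 0 := by
  have htor := pow_smul_continuousCohomology_two_eq_zero S w θ' k Λ hΛo
  rcases Nat.lt_or_ge k 2 with hk | hk
  · have hsplit : 2 ^ 3 = 2 ^ (3 - k) * 2 ^ k := by rw [← pow_add]; congr 1; omega
    rw [hsplit, mul_nsmul', htor c, smul_zero]
  · have h4 := four_smul_eq_zero_of_apply_eq_neg_one 2 θ' S k w Λ hk (hμ k) hΛo habΛ (fun s => hθ2 _) g₀ hg₀ hθg₀ c
    rw [show (2 ^ 3 : ℕ) = 2 * 4 from rfl, mul_nsmul', h4, smul_zero]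

end LocalLaws

/-! ## §3. The two clauses of `hplaces` at a place, from a decomposition / an inertia element -/

section Clauses

variable {K : Type} [Field K] [NumberField K] (θ' : absoluteGaloisGroup K →ₜ* ℤ_[2]ˣ)
  (S : Set (HeightOneSpectrum (𝓞 K))) (κ₁ κ₂ : ZpExtension K 2) (w : HeightOneSpectrum (𝓞 K))
  (hμ : ∀ k : ℕ, ramificationSubgroup K S ≤ ContinuousRep.ker (muTwist 2 θ' k))
  (hθ2 : ∀ s : absoluteGaloisGroup K, θ' s = 1 ∨ θ' s = -1)

include hμ hθ2 in
/-- **The (LI-conj) clause of `hplaces` at `w` for a pin `η` that DECOMPOSES at `w`** (`η = res_w(δ)·h`, `h ∈ Gal(K̄/K̃_∞)`), with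
`u = θ′(res_w δ) ∈ {±1}` and `e = 3`. [cite: JohnsonLeungKings2011, §5.4 Lemma 5.8 (proof)] -/
theorem conjClause_of_decomp {η : absoluteGaloisGroup K} {δ : absoluteGaloisGroup (w.adicCompletion K)} {h : absoluteGaloisGroup K}
    (hh : h ∈ ZpExtension.pairKer κ₁ κ₂) (hdec : η = absGaloisRestrict K (w.adicCompletion K) δ * h) :
    ∃ (δ : absoluteGaloisGroup (w.adicCompletion K)) (h : absoluteGaloisGroup K) (u : ℤ),
      h ∈ ZpExtension.pairKer κ₁ κ₂ ∧ η = absGaloisRestrict K (w.adicCompletion K) δ * h ∧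
      ∀ (n k : ℕ) (c : continuousCohomology 2 (subgroupRep
        (TopRep.res (locHom (S := S) w : absoluteGaloisGroup (w.adicCompletion K) →* GaloisGroupUnramifiedOutside K S)
          ((muTwist 2 θ' k).quotientInvariants (ramificationSubgroup K S)).toTopRep)
        (((pairLayerSubgroup κ₁ κ₂ n).map (toUnramifiedQuot K S)).comap
          (locHom (S := S) w : absoluteGaloisGroup (w.adicCompletion K) →* GaloisGroupUnramifiedOutside K S)))),
        2 ^ 3 • ((conjMap (TopRep.res (locHom (S := S) w : absoluteGaloisGroup (w.adicCompletion K) →*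
            GaloisGroupUnramifiedOutside K S) ((muTwist 2 θ' k).quotientInvariants (ramificationSubgroup K S)).toTopRep)
          (((pairLayerSubgroup κ₁ κ₂ n).map (toUnramifiedQuot K S)).comap
            (locHom (S := S) w : absoluteGaloisGroup (w.adicCompletion K) →* GaloisGroupUnramifiedOutside K S)) δ 2).hom c -
          u • c) = 0 := by
  have law : ∀ (u : ℤ), (θ' (absGaloisRestrict K (w.adicCompletion K) δ) = 1 ∧ u = 1 ∨
      θ' (absGaloisRestrict K (w.adicCompletion K) δ) = -1 ∧ u = -1) →
      ∀ (n k : ℕ) (c : continuousCohomology 2 (subgroupRep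
        (TopRep.res (locHom (S := S) w : absoluteGaloisGroup (w.adicCompletion K) →* GaloisGroupUnramifiedOutside K S)
          ((muTwist 2 θ' k).quotientInvariants (ramificationSubgroup K S)).toTopRep)
        (((pairLayerSubgroup κ₁ κ₂ n).map (toUnramifiedQuot K S)).comap
          (locHom (S := S) w : absoluteGaloisGroup (w.adicCompletion K) →* GaloisGroupUnramifiedOutside K S)))),
        2 ^ 3 • ((conjMap (TopRep.res (locHom (S := S) w : absoluteGaloisGroup (w.adicCompletion K) →*
            GaloisGroupUnramifiedOutside K S) ((muTwist 2 θ' k).quotientInvariants (ramificationSubgroup K S)).toTopRep)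
          (((pairLayerSubgroup κ₁ κ₂ n).map (toUnramifiedQuot K S)).comap
            (locHom (S := S) w : absoluteGaloisGroup (w.adicCompletion K) →* GaloisGroupUnramifiedOutside K S)) δ 2).hom c -
          u • c) = 0 := fun u hu n k c => by
    haveI := normal_comap_locHom_map_pairLayerSubgroup κ₁ κ₂ S w n
    exact pow_three_smul_conjMap_sub_zsmul_eq_zero θ' S w hμ hθ2 _ (isOpen_comap_locHom_map_pairLayerSubgroup κ₁ κ₂ S w n)
      (commutator_mem_comap_locHom_map_pairLayerSubgroup κ₁ κ₂ S w n) δ hu k c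
  rcases hθ2 (absGaloisRestrict K (w.adicCompletion K) δ) with h1 | h1
  · exact ⟨δ, h, 1, hh, hdec, law 1 (Or.inl ⟨h1, rfl⟩)⟩
  · exact ⟨δ, h, -1, hh, hdec, law (-1) (Or.inr ⟨h1, rfl⟩)⟩

include hμ hθ2 in
/-- **The (LI-ram) clause of `hplaces` at `w` from an inertia-type element**: `g₀ ∈ Γ_{K_w}` with `res_w g₀ ∈ Gal(K̄/K̃_∞)` (so `g₀` lies in
every local layer group) and `θ′(res_w g₀) = −1` kills all the local `H²`'s by `2³`. [cite: JohnsonLeungKings2011, §5.4 Lemma 5.8 (proof)] -/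
theorem killClause_of_mem_pairKer {g₀ : absoluteGaloisGroup (w.adicCompletion K)}
    (hg₀ : absGaloisRestrict K (w.adicCompletion K) g₀ ∈ ZpExtension.pairKer κ₁ κ₂)
    (hθg₀ : θ' (absGaloisRestrict K (w.adicCompletion K) g₀) = -1) :
    ∀ (n k : ℕ) (c : continuousCohomology 2 (subgroupRep
        (TopRep.res (locHom (S := S) w : absoluteGaloisGroup (w.adicCompletion K) →* GaloisGroupUnramifiedOutside K S)
          ((muTwist 2 θ' k).quotientInvariants (ramificationSubgroup K S)).toTopRep)
        (((pairLayerSubgroup κ₁ κ₂ n).map (toUnramifiedQuot K S)).comap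
          (locHom (S := S) w : absoluteGaloisGroup (w.adicCompletion K) →* GaloisGroupUnramifiedOutside K S)))),
      2 ^ 3 • c = 0 := fun n k c => by
  haveI := normal_comap_locHom_map_pairLayerSubgroup κ₁ κ₂ S w n
  exact pow_three_smul_eq_zero_of_apply_eq_neg_one θ' S w hμ hθ2 _ (isOpen_comap_locHom_map_pairLayerSubgroup κ₁ κ₂ S w n)
    (commutator_mem_comap_locHom_map_pairLayerSubgroup κ₁ κ₂ S w n) (mem_comap_locHom_map_pairLayerSubgroup_of_mem_pairKer κ₁ κ₂ S w n hg₀)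
    hθg₀ k c

end Clauses

end Summit.BirchSwinnertonDyer.BirchSwinnertonDyer.Theorems.PrintCf2.JLKDescent

end
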